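import Mathlib
import Summits.Ventures.HodgeRepro.ZariskiWedge

/-!
# R5 steps (4)–(5) for SEVERAL simple factors: Zariski density of a product of number fields and
the rational point (seat p3)

ROUTE-C R5 step (5) runs step (4) "on `∏_i M^{(i)}` with the total count `Σ g′_i ≤ p`" — several
simple factors `B_i` with DIFFERENT CM fields `T_i = End⁰(B_i)`, each with its multiplicity space
`M^{(i)} ≅ T_i^{m_i}` — and the route's sentence is: *the image of `∏_i M^{(i)} → ∏_i ∏_{σ ∈ Ψ_{T_i}}
M^{(i)}_σ` is Zariski dense, so some rational point has non-zero wedge.*  Seat typer-2's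
`ZariskiDense.lean` kernel-checks the density for ONE number field (`exists_eval_embeddings_ne_zero`,
several copies of the same field in `exists_eval_embeddings_pi_ne_zero`) and its docstring names the
block-diagonal surjection as the tool for several corners; seat p3's `ZariskiWedge.lean` derives the
rational point for one field.  This file supplies the several-fields version:

* `sum_blockEmb` + `surjective_blockEmb`: the block-diagonal coordinate map
  `ℂ^{Σ_b [K_b:ℚ]} → ℂ^{Σ_b Hom(K_b,ℂ)}` over a finite family of number fields `K b` (`b : β` — a
  "block"; the route's blocks are the pairs (factor, copy)) is surjective.  It is written without
  dependent casts: the basis vector of the block `p.1` is read in the block `s.1` through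
  `Pi.single`, which is `0` unless the blocks agree.
* **`exists_eval_embeddings_sigma_ne_zero`**: every non-zero polynomial in the variables
  `Σ b, Hom(K_b, ℂ)` is non-zero at some point `(σ(a_b))_{b,σ}` with `a_b ∈ K_b` — the ℚ-points
  `∏_b K_b` are Zariski dense in `∏_b ℂ^{Hom(K_b,ℂ)}` (typer-2's `exists_rat_eval_ne_zero_of_surjective`
  on the block-diagonal surjection).
* **`exists_rat_linearIndependent_blocks`** (R5 step (4) for several factors): eigenform `i` lives in
  the block `(e i).1` (its factor and copy) and the embedding `(e i).2 ∈ Hom(K_{(e i).1}, ℂ)`; its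
  evaluation at the point is a `ℂ`-linear map `ω i : ℂ^{m_{(e i).1}} → ℂ^p` on the block's own
  multiplicity space.  If SOME complex data make the evaluated eigenforms independent, SOME rational
  data `v b ∈ K_b^{m_b}` (one vector per block) do — the determinant-polynomial argument of
  `ZariskiWedge.exists_rat_linearIndependent` with the several-fields density.
* `exists_rat_linearIndependent_of_surjective_blocks` (steps (3)+(4) together): each `ω i`
  surjective onto `ℂ^p` and `|ι| ≤ p` ⇒ a rational point with `|ι|` independent evaluated eigenforms.
* `linearIndependent_of_linearIndependent_eval_blocks` (step (5)'s remark «this also shows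
  `dim_T M ≥ m`», several factors): independent evaluated eigenforms over all factors and copies ⇒
  for each factor the rational vectors of its copies are independent over that factor's field.

Everything is Mathlib plus typer-2's `ZariskiDense.lean` and p3's `ZariskiWedge.lean`; no
Hodge-theoretic object is modelled (13.2(a)/(c) of ROUTE-C stay paper sentences).  Nothing here says
anything about the status of the Hodge conjecture for CM abelian varieties, which is NOT proved.
-/

set_option autoImplicit false

namespace HodgeRepro.Zariski

open MvPolynomial Matrix Module

section density

variable {β : Type*} [Fintype β] [DecidableEq β]
variable (K : β → Type*) [∀ b, Field (K b)] [∀ b, NumberField (K b)]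

/-- The block-diagonal coordinate matrix, summed against a vector: only the block of `s` survives,
and there it is the coordinate map of `ZariskiDense.surjective_embCoord` for the field `K s.1`. -/
theorem sum_blockEmb (s : Σ b, (K b →ₐ[ℚ] ℂ)) (x : (Σ b, Fin (finrank ℚ (K b))) → ℂ) :
    ∑ p : Σ b, Fin (finrank ℚ (K b)),
      (if p.1 = s.1 then s.2 (Pi.single p.1 (Module.finBasis ℚ (K p.1) p.2) s.1) else 0) * x p
      = ∑ j, s.2 (Module.finBasis ℚ (K s.1) j) * x ⟨s.1, j⟩ := by
  obtain ⟨b, σ⟩ := s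
  rw [Fintype.sum_sigma]
  rw [Finset.sum_eq_single b]
  · refine Finset.sum_congr rfl fun j _ => ?_
    simp only [if_true, Pi.single_eq_same]
  · intro b' _ hb'
    refine Finset.sum_eq_zero fun j _ => ?_
    simp only [hb', if_false, zero_mul]
  · intro h
    exact absurd (Finset.mem_univ b) h

/-- The block-diagonal coordinate map `ℂ^{Σ_b [K_b:ℚ]} → ℂ^{Σ_b Hom(K_b,ℂ)}` is surjective: one
copy of `ℂ ⊗_ℚ K_b ≅ ℂ^{Hom(K_b,ℂ)}` (typer-2's `surjective_embCoord`) per block. -/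
theorem surjective_blockEmb :
    Function.Surjective fun x : (Σ b, Fin (finrank ℚ (K b))) → ℂ =>
      fun s : Σ b, (K b →ₐ[ℚ] ℂ) =>
        ∑ p : Σ b, Fin (finrank ℚ (K b)),
          (if p.1 = s.1 then s.2 (Pi.single p.1 (Module.finBasis ℚ (K p.1) p.2) s.1) else 0) * x p := by
  intro v
  have h := fun b : β => surjective_embCoord (K b) (fun σ => v ⟨b, σ⟩)
  choose x hx using h
  refine ⟨fun p => x p.1 p.2, ?_⟩
  funext s
  dsimp only
  rw [sum_blockEmb]
  obtain ⟨b, σ⟩ := s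
  exact congrFun (hx b) σ

/-- **Zariski density of the ℚ-points of a product of number fields (R5 step (5), several
factors).**  For a finite family of number fields `K b`, every non-zero polynomial function on
`∏_b ℂ^{Hom(K_b,ℂ)}` is non-zero at some point `(σ(a_b))_{b, σ}` with `a_b ∈ K_b`. -/
theorem exists_eval_embeddings_sigma_ne_zero (P : MvPolynomial (Σ b, (K b →ₐ[ℚ] ℂ)) ℂ)
    (hP : P ≠ 0) :
    ∃ a : (b : β) → K b, eval (fun s => s.2 (a s.1)) P ≠ 0 := by
  obtain ⟨q, hq⟩ := exists_rat_eval_ne_zero_of_surjective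
    (fun (s : Σ b, (K b →ₐ[ℚ] ℂ)) (p : Σ b, Fin (finrank ℚ (K b))) =>
      if p.1 = s.1 then s.2 (Pi.single p.1 (Module.finBasis ℚ (K p.1) p.2) s.1) else 0)
    (surjective_blockEmb K) P hP
  refine ⟨fun b => ∑ j, q ⟨b, j⟩ • Module.finBasis ℚ (K b) j, ?_⟩
  convert hq using 3
  funext s
  rw [sum_blockEmb, map_sum]
  refine Finset.sum_congr rfl fun j _ => ?_
  have hs : s.2 (q ⟨s.1, j⟩ • Module.finBasis ℚ (K s.1) j) =
      q ⟨s.1, j⟩ • s.2 (Module.finBasis ℚ (K s.1) j) :=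
    s.2.toLinearMap.map_smul (q ⟨s.1, j⟩) (Module.finBasis ℚ (K s.1) j)
  rw [hs, Rat.smul_def, mul_comm]

end density

section main

variable {ι p : Type*} [Fintype ι] [DecidableEq ι] [Fintype p] [DecidableEq p]
variable {β : Type*} [Fintype β] [DecidableEq β]
variable (K : β → Type*) [∀ b, Field (K b)] [∀ b, NumberField (K b)]
variable (m : β → Type*) [∀ b, Fintype (m b)] [∀ b, DecidableEq (m b)]

/-- **R5 step (4), the rational point, several factors.**  Blocks `b : β` (the pairs (factor,
copy) of R5 step (5)), each with its number field `K b` and multiplicity space `ℂ^{m b}`; eigenform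
`i` sits in the block `(e i).1` with the embedding `(e i).2 : K (e i).1 → ℂ` (`e` injective: distinct
eigenforms are distinct (block, embedding) pairs) and is evaluated by the `ℂ`-linear map
`ω i : ℂ^{m (e i).1} → ℂ^p`.  If some complex data `w` make `(ω i (w i))_i` linearly independent,
some rational data `v b ∈ K_b^{m b}` make `(ω i ((e i).2 (v (e i).1 j))_j)_i` linearly independent.

Proof: as in `ZariskiWedge.exists_rat_linearIndependent` — `B` a left inverse of the matrix with
columns `ω i (w i)`; `P := det (B * U(x))` in the variables `x : (Σ b, m b × Hom(K_b,ℂ)) → ℂ`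
(here written as `Σ q : (Σ b, m b), Hom(K_{q.1},ℂ)`), with `P = 1` at the assignment carrying `w`;
the several-fields density gives a rational point with `P ≠ 0`, i.e. `B * U(v)` invertible. -/
theorem exists_rat_linearIndependent_blocks (e : ι → Σ b, (K b →ₐ[ℚ] ℂ))
    (he : Function.Injective e) (ω : ∀ i, ((m (e i).1 → ℂ) →ₗ[ℂ] (p → ℂ)))
    (w : ∀ i, m (e i).1 → ℂ) (hw : LinearIndependent ℂ fun i => ω i (w i)) :
    ∃ v : (b : β) → m b → K b,
      LinearIndependent ℂ fun i => ω i (fun j => (e i).2 (v (e i).1 j)) := by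
  classical
  -- the variables: one per (block, multiplicity coordinate, embedding)
  let V := Σ q : (Σ b, m b), (K q.1 →ₐ[ℚ] ℂ)
  set A : ∀ i, Matrix p (m (e i).1) ℂ := fun i => LinearMap.toMatrix' (ω i) with hA
  have hAω : ∀ i (x : m (e i).1 → ℂ), A i *ᵥ x = ω i x :=
    fun i x => LinearMap.toMatrix'_mulVec (ω i) x
  obtain ⟨B, hB⟩ := exists_leftInverse_of_linearIndependent (fun i => ω i (w i)) hw
  -- the vector in `ℂ^{m (e i).1}` that an assignment `x` of the variables produces for `i`
  set readVec : (V → ℂ) → ∀ i, m (e i).1 → ℂ :=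
    fun x i j => x ⟨⟨(e i).1, j⟩, (e i).2⟩ with hread
  -- the determinant polynomial `det (B * U(x))`
  set P : MvPolynomial V ℂ :=
    Matrix.det (Matrix.of fun i i' =>
      ∑ r', C (B i r') * ∑ j, C (A i' r' j) * X (⟨⟨(e i').1, j⟩, (e i').2⟩ : V)) with hP
  have hevalP : ∀ x : V → ℂ,
      eval x P = (B * Matrix.of fun r' i => (A i *ᵥ readVec x i) r').det := by
    intro x
    rw [hP, RingHom.map_det]
    congr 1
    ext i i'
    simp only [RingHom.mapMatrix_apply, Matrix.map_apply, Matrix.of_apply, map_sum, map_mul,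
      eval_C, eval_X, Matrix.mul_apply, Matrix.mulVec, dotProduct, hread]
  -- the assignment carrying the complex witness `w` (cast-free: compare variable indices)
  set x₀ : V → ℂ :=
    fun s => ∑ i, ∑ j', if (⟨⟨(e i).1, j'⟩, (e i).2⟩ : V) = s then w i j' else 0 with hx₀
  have hread₀ : ∀ i, readVec x₀ i = w i := by
    intro i
    funext j
    simp only [hread, hx₀]
    rw [Finset.sum_eq_single i]
    · rw [Finset.sum_eq_single j]
      · exact if_pos rfl
      · intro j' _ hj'
        rw [if_neg]
        intro h
        have h1 := (Sigma.mk.inj_iff.1 h).1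
        have h2 := (Sigma.mk.inj_iff.1 h1).2
        exact hj' (eq_of_heq h2)
      · intro h
        exact absurd (Finset.mem_univ j) h
    · intro i' _ hi'
      refine Finset.sum_eq_zero fun j' _ => ?_
      rw [if_neg]
      intro h
      have h1 := (Sigma.mk.inj_iff.1 h).1
      have h2 := (Sigma.mk.inj_iff.1 h).2
      have h3 : (e i').1 = (e i).1 := (Sigma.mk.inj_iff.1 h1).1
      exact hi' (he (Sigma.ext h3 h2))
    · intro h
      exact absurd (Finset.mem_univ i) h
  have hPne : P ≠ 0 := by
    intro h0
    have h1 := hevalP x₀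
    rw [h0, map_zero] at h1
    have h2 : (Matrix.of fun r' i => (A i *ᵥ readVec x₀ i) r') =
        Matrix.of fun r' i => ω i (w i) r' := by
      ext r' i
      rw [Matrix.of_apply, Matrix.of_apply, hread₀, hAω]
    rw [h2, hB, Matrix.det_one] at h1
    exact zero_ne_one h1
  -- the several-fields density, with the blocks `(b, j) : Σ b, m b` and the fields `K b`
  obtain ⟨v', hv'⟩ := exists_eval_embeddings_sigma_ne_zero (fun q : Σ b, m b => K q.1) P hPne
  refine ⟨fun b j => v' ⟨b, j⟩, ?_⟩
  rw [hevalP] at hv'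
  have hunit : IsUnit (B * Matrix.of fun r' i =>
      (A i *ᵥ readVec (fun s => s.2 (v' s.1)) i) r') :=
    (Matrix.isUnit_iff_isUnit_det _).mpr (isUnit_iff_ne_zero.mpr hv')
  have hli := linearIndependent_of_isUnit_mul _ B hunit
  convert hli using 1
  funext i
  rw [← hAω]

/-- **R5 steps (3)+(4), several factors.**  If each `ω i` is surjective onto `ℂ^p` ("each
eigen-system spans `T_x^*`", step (3)) and `|ι| ≤ p`, there is a rational point — one vector
`v b ∈ K_b^{m b}` per block — at which the `|ι|` evaluated eigenforms are linearly independent. -/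
theorem exists_rat_linearIndependent_of_surjective_blocks (e : ι → Σ b, (K b →ₐ[ℚ] ℂ))
    (he : Function.Injective e) (ω : ∀ i, ((m (e i).1 → ℂ) →ₗ[ℂ] (p → ℂ)))
    (hω : ∀ i, Function.Surjective (ω i)) (hcard : Fintype.card ι ≤ Fintype.card p) :
    ∃ v : (b : β) → m b → K b,
      LinearIndependent ℂ fun i => ω i (fun j => (e i).2 (v (e i).1 j)) := by
  obtain ⟨f⟩ := Function.Embedding.nonempty_of_card_le hcard
  choose w hw using fun i => hω i (Pi.single (f i) 1)
  have hli : LinearIndependent ℂ fun i => ω i (w i) := by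
    simp only [hw]
    exact (Pi.linearIndependent_single_one p ℂ).comp f f.injective
  exact exists_rat_linearIndependent_blocks K m e he ω w hli

end main

section copies

variable {ι₀ r p : Type*} [Fintype r]
variable (K : ι₀ → Type*) [∀ i, Field (K i)] [∀ i, NumberField (K i)]
variable (m Ψ : ι₀ → Type*)

/-- **R5 step (5), the remark «this also shows `dim_T M ≥ r`», several factors.**  Factors
`i : ι₀` with fields `K i`, multiplicity spaces `ℂ^{m i}`, eigen-indices `Ψ i` (the CM type of
`K i`), `r` copies of each.  If ALL the evaluated eigenforms `Ω i ψ ((σ i ψ (v i l j))_j)` — over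
every factor `i`, copy `l` and eigen-index `ψ` — are linearly independent over `ℂ`, then for every
factor `i₀` with `Ψ i₀` non-empty the `r` rational vectors `v i₀ l ∈ (K i₀)^{m i₀}` are linearly
independent over `K i₀` (restrict to the factor `i₀` and apply the one-field remark
`ZariskiWedge.linearIndependent_of_linearIndependent_eval`). -/
theorem linearIndependent_of_linearIndependent_eval_blocks (σ : ∀ i, Ψ i → (K i →ₐ[ℚ] ℂ))
    (Ω : ∀ i, Ψ i → ((m i → ℂ) →ₗ[ℂ] (p → ℂ))) (v : ∀ i, r → m i → K i)
    (hli : LinearIndependent ℂ fun q : Σ i, (r × Ψ i) =>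
      Ω q.1 q.2.2 (fun j => σ q.1 q.2.2 (v q.1 q.2.1 j)))
    (i₀ : ι₀) [Nonempty (Ψ i₀)] : LinearIndependent (K i₀) (v i₀) := by
  have hsub : LinearIndependent ℂ fun q : r × Ψ i₀ =>
      Ω i₀ q.2 (fun j => σ i₀ q.2 (v i₀ q.1 j)) :=
    hli.comp (fun q : r × Ψ i₀ => ⟨i₀, q⟩) (fun a b h => eq_of_heq (Sigma.mk.inj_iff.1 h).2)
  exact linearIndependent_of_linearIndependent_eval (K i₀) (σ i₀) (Ω i₀) (v i₀) hsub

end copies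

end HodgeRepro.Zariski
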